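import Summits.HubbardSuperconductivity.HubbardSuperconductivity.Theorems.KLProgrammeKLRegimeScaleZeroRecordPairRegistered
import Summits.HubbardSuperconductivity.HubbardSuperconductivity.Theorems.KLProgrammePerturbedFermiCurveNumerics
import Summits.HubbardSuperconductivity.HubbardSuperconductivity.Theorems.KLProgrammeKLRegimeEngineScaleZeroTwoLegBareFrameJets

/-!
# Route `KLProgramme`, crux K3 — ENGINE (stmt-HubbardSuperconductivity-20437), row (C) `stub_twoLeg_curvature`, the SCALE-0 PRIVATE PAIR of `hres′` FROM THE RECORD ROWS,
# part 4: the free Fermi-point sizes of orders 3, 4 are ANALYTIC — the record interface is {bS₁, bS₂, sS₃, sS₄, D₁, D₂}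

Seat hubbard-kl-k3c5-p1 (g20).  In part 3 (`…ScaleZeroRecordPairRegistered`) the curve sizes `D 1 … D 4` of `γ₀ = toLp ∘ klFermiPoint μ 0` were record inputs.  Orders 3 and 4
only multiply tail / aliasing coefficients (`≤ 10⁻⁸⁰`), so the tree's crude analytic sizes suffice: `fermiPointLp_sizes_explicit` (k3c3-p3, `…PerturbedFermiCurveTower`) at the
BARE frame (`K = 0`, `R₀ = 0`, auxiliary `c := klCurveC3 R₀`, `U₁ := min (klCurveU0 R₀) √(c/5)`, `β := e^{c/U₁²} ≥ klBetaMin` — none of which the free curve sees) with the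
numerals of `…PerturbedFermiCurveNumerics` (`klCurveD3 0 ≤ 6.5·10⁹`, `klCurveD4 0 0 ≤ 9.9·10¹³`; also `D1 ≤ 231`, `D2 ≤ 7·10⁵`, too crude for the k = 1, 2 fits).
* **`freeFermiPointLp_sizes_numeral`** — `μ ∈ klWindowC ⇒ ‖γ₀′‖ ≤ 231`, `‖γ₀″‖ ≤ 700000`, `‖γ₀‴‖ ≤ 6500000000`, `‖γ₀⁗‖ ≤ 99000000000000` at every angle;
* **`twoLegRead_frameZero_registered_of_records₁₂`** — the REGISTERED scale-`0` pair from `hS12` (#22a, k = 1, 2), `hSjet` (#22b, k = 3, 4), TWO curve sizes `D₁, D₂`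
  (`‖γ₀′‖ ≤ D₁`, `‖γ₀″‖ ≤ D₂`: the `D₁ = 3.23`-class certificates) and the four fits with `δ₁₂ := (1 + D₁ + D₂ + 6500000000 + 99000000000000)⁴/10⁷⁸`;
* **`twoLegRead_frameZero_registered_klEngGQ_of_records₁₂`** — the (C) closer's prefix form from ONE pointwise record hypothesis in this six-number currency.
Proofs only; no definitions; nothing here asserts (C), any stub of 20437, K3 or superconductivity; the record rows are HYPOTHESES (kit records, FROZEN).
References: BGM 2006 §2.4 Lemma 2.1 (2.36)–(2.42) [cite: BenfattoGiulianiMastropietro2006].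
-/

noncomputable section

namespace Summit.HubbardSuperconductivity.HubbardSuperconductivity.Theorems.KLRegimeSplit

set_option linter.dupNamespace false -- summit = problem name (single-conjunct summit), D-0017

open Real Finset Complex Literature.MathematicalPhysics.QuantumLattice Literature.Probability.LatticeModels GrassmannAlgebra Matrix
open Literature.MathematicalPhysics.QuantumLattice.FermiRG Literature.Probability.LatticeModels.BattleFederbush
open Summit.HubbardSuperconductivity.HubbardSuperconductivity.Theorems.KLProgrammeLegKernels
open Summit.HubbardSuperconductivity.HubbardSuperconductivity.Theorems.TwoLegFourier
open Summit.HubbardSuperconductivity.HubbardSuperconductivity.Theorems.EngineV8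
open Summit.HubbardSuperconductivity.HubbardSuperconductivity.Theorems.PerturbedFermiCurve
open Summit.HubbardSuperconductivity.HubbardSuperconductivity.Theorems.DispersionFlow
open scoped Nat

variable {L M : ℕ} [NeZero L] [NeZero M] {μ U β : ℝ}

/-! ## §1 The free Fermi-point map: numeral sizes of orders 1–4 on the window -/

omit [NeZero L] [NeZero M] in
/-- **NUMERAL SIZES OF THE FREE FERMI-POINT MAP ON `klWindowC`**: `‖γ₀′(θ)‖ ≤ 231`, `‖γ₀″(θ)‖ ≤ 7·10⁵`, `‖γ₀‴(θ)‖ ≤ 6.5·10⁹`, `‖γ₀⁗(θ)‖ ≤ 9.9·10¹³`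
(`fermiPointLp_sizes_explicit` at the bare frame, `…PerturbedFermiCurveNumerics`). [cite: BenfattoGiulianiMastropietro2006, §2.4 Lemma 2.1 (2.40)] -/
theorem freeFermiPointLp_sizes_numeral (hμ : μ ∈ klWindowC) (θ : ℝ) :
    ‖iteratedDeriv 1 (fun θ : ℝ => (WithLp.toLp 2 (klFermiPoint μ 0 θ) : Momentum)) θ‖ ≤ 231 ∧
    ‖iteratedDeriv 2 (fun θ : ℝ => (WithLp.toLp 2 (klFermiPoint μ 0 θ) : Momentum)) θ‖ ≤ 700000 ∧
    ‖iteratedDeriv 3 (fun θ : ℝ => (WithLp.toLp 2 (klFermiPoint μ 0 θ) : Momentum)) θ‖ ≤ 6500000000 ∧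
    ‖iteratedDeriv 4 (fun θ : ℝ => (WithLp.toLp 2 (klFermiPoint μ 0 θ) : Momentum)) θ‖ ≤ 99000000000000 := by
  have hR : ∀ j, 0 ≤ (⟨0, 0, fun _ => 0⟩ : RenConsts).Gfr j := fun _ => le_rfl
  have hRW : (⟨0, 0, fun _ => 0⟩ : RenConsts).WF := ⟨le_rfl, le_rfl, hR⟩
  have hc₃ := klCurveC3_pos hR
  have hU₀ := klCurveU0_pos hR
  set c₃ : ℝ := klCurveC3 (⟨0, 0, fun _ => 0⟩ : RenConsts) with hc₃def
  set U₁ : ℝ := min (klCurveU0 (⟨0, 0, fun _ => 0⟩ : RenConsts)) (Real.sqrt (c₃ / 5)) with hU₁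
  have hs : 0 < Real.sqrt (c₃ / 5) := Real.sqrt_pos.2 (by positivity)
  have hU₁0 : 0 < U₁ := lt_min hU₀ hs
  have hU₁le : U₁ ≤ klCurveU0 (⟨0, 0, fun _ => 0⟩ : RenConsts) := min_le_left _ _
  have hβ : klBetaMin ≤ Real.exp (c₃ / U₁ ^ 2) := by
    have h1 : U₁ ^ 2 ≤ c₃ / 5 := by
      have h2 : U₁ ≤ Real.sqrt (c₃ / 5) := min_le_right _ _
      have h3 : U₁ ^ 2 ≤ Real.sqrt (c₃ / 5) ^ 2 := pow_le_pow_left₀ hU₁0.le h2 2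
      rwa [Real.sq_sqrt (by positivity)] at h3
    have h5 : (5 : ℝ) ≤ c₃ / U₁ ^ 2 := by
      rw [le_div_iff₀ (by positivity)]; linarith
    have he : Real.exp 5 ≥ 128 := by
      have h2 : (2.7 : ℝ) ≤ Real.exp 1 := by have := Real.exp_one_gt_d9; norm_num at this; linarith
      have : Real.exp 5 = Real.exp 1 ^ 5 := by rw [← Real.exp_nat_mul]; norm_num
      rw [this]
      have h3 : (2.7 : ℝ) ^ 5 ≤ Real.exp 1 ^ 5 := pow_le_pow_left₀ (by norm_num) h2 5
      have h4 : (128 : ℝ) ≤ (2.7 : ℝ) ^ 5 := by norm_num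
      linarith
    have : Real.exp 5 ≤ Real.exp (c₃ / U₁ ^ 2) := Real.exp_le_exp.2 h5
    simp only [klBetaMin]; linarith
  have hK : FrameOK (⟨0, 0, fun _ => 0⟩ : RenConsts) U₁ (nScales (Real.exp (c₃ / U₁ ^ 2))) μ 0 := klFrameOK_zeroC hRW U₁ _ hμ
  have hA₃ : ∀ p : Momentum, ‖iteratedFDeriv ℝ 3 (frameShift (0 : TrigPolyC4v)) p‖ ≤ 0 := fun p => norm_iteratedFDeriv_frameShift_zero 3 p
  have hA₄ : ∀ p : Momentum, ‖iteratedFDeriv ℝ 4 (frameShift (0 : TrigPolyC4v)) p‖ ≤ 0 := fun p => norm_iteratedFDeriv_frameShift_zero 4 p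
  obtain ⟨-, h1, h2, h3, h4⟩ := fermiPointLp_sizes_explicit hR hc₃ le_rfl hU₁0 hU₁le hβ le_rfl hμ hK hA₃ hA₄ θ
  rw [norm_iteratedFDeriv_eq_norm_iteratedDeriv] at h1 h2 h3 h4
  refine ⟨h1.trans klCurveD1_le, h2.trans klCurveD2_le, h3.trans ((klCurveD3_le le_rfl).trans (by norm_num)),
    h4.trans ((klCurveD4_le le_rfl le_rfl).trans (by norm_num))⟩

/-! ## §2 The REGISTERED scale-`0` pair in the six-number record currency -/

/-- **THE REGISTERED SCALE-0 PAIR FROM `bS₁, bS₂` (#22a), `sS₃, sS₄` (#22b), `D₁, D₂` (curve sizes of orders 1, 2) AND FOUR FITS** — orders 3, 4 of the curve are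
analytic (`freeFermiPointLp_sizes_numeral`); `δ₁₂ = (1 + D₁ + D₂ + 6500000000 + 99000000000000)⁴/10⁷⁸`. [cite: BenfattoGiulianiMastropietro2006, §2.4 Lemma 2.1 (2.36)-(2.42)] -/
theorem twoLegRead_frameZero_registered_of_records₁₂ (P : SplitConsts) (R : RenConsts) (hβ : klBetaMin ≤ β) (hμ : μ ∈ klWindowC) (hU : 0 < U)
    (hUb : U ≤ klTailBookU) (hL : klEngL₃ β U ≤ L) (hM : klEngM₃ β U L ≤ M) {bS sS : ℕ → ℝ} {D₁ D₂ : ℝ}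
    (hS12 : ∀ k, 1 ≤ k → k ≤ 2 → ∀ (σ : Fin 2) (p₀ : GridPoint L (2 * (2 * M))), ∑ p₁ : GridPoint L (2 * (2 * M)),
      (if p₁ = p₀ then (0 : ℝ) else
        Real.sqrt ((((p₁.2 - p₀.2) 0).valMinAbs.natAbs : ℝ) ^ 2 + (((p₁.2 - p₀.2) 1).valMinAbs.natAbs : ℝ) ^ 2) ^ k * ‖contr ℂ ((hubbardGridSub L M β (2 * (2 * M))).transpose * hubbardCovAboveCT L M β μ 0 0 klE0 *
                hubbardGridSub L M β (2 * (2 * M))) (((p₁, σ), 0) : GridLeg (GridPoint L (2 * (2 * M)))) ((p₀, σ), 1) *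
              (contr ℂ ((hubbardGridSub L M β (2 * (2 * M))).transpose * hubbardCovAboveCT L M β μ 0 0 klE0 *
                hubbardGridSub L M β (2 * (2 * M))) (((p₀, σ.rev), 0) : GridLeg (GridPoint L (2 * (2 * M)))) ((p₁, σ.rev), 1) *
                contr ℂ ((hubbardGridSub L M β (2 * (2 * M))).transpose * hubbardCovAboveCT L M β μ 0 0 klE0 *
                hubbardGridSub L M β (2 * (2 * M))) (((p₁, σ.rev), 0) : GridLeg (GridPoint L (2 * (2 * M)))) ((p₀, σ.rev), 1))‖) ≤
        bS k * (((2 * (2 * M) : ℕ) : ℝ) / β))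
    (hSjet : ∀ k, 3 ≤ k → k ≤ 4 → ∀ θ : ℝ, |iteratedDeriv k (fun θ : ℝ => evalM (symInterp L (fun pp : TorusSite 2 L =>
        (∑ σσ : Fin 2, ((selfEnergy L M β (ExteriorAlgebra.map (Matrix.toLin' (gridSubMatrix L M β
            (fun p : GridPoint L (2 * (2 * M)) => p.2) (fun p => gridTime β (2 * (2 * M)) p.1)))
          (∑ p' : GridPoint L (2 * (2 * M)), ∑ q' : GridPoint L (2 * (2 * M)), ∑ σ' : Fin 2,
          (if p' = q' then (0 : ℂ) else
            -((((U * (β / (2 * (2 * M) : ℕ)) : ℝ) : ℂ) ^ 2 *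
              (contr ℂ ((hubbardGridSub L M β (2 * (2 * M))).transpose * hubbardCovAboveCT L M β μ 0 0 klE0 *
                  hubbardGridSub L M β (2 * (2 * M))) (((q', σ'), 0) : GridLeg (GridPoint L (2 * (2 * M)))) ((p', σ'), 1) *
                (contr ℂ ((hubbardGridSub L M β (2 * (2 * M))).transpose * hubbardCovAboveCT L M β μ 0 0 klE0 *
                    hubbardGridSub L M β (2 * (2 * M))) (((p', σ'.rev), 0) : GridLeg (GridPoint L (2 * (2 * M)))) ((q', σ'.rev), 1) *
                  contr ℂ ((hubbardGridSub L M β (2 * (2 * M))).transpose * hubbardCovAboveCT L M β μ 0 0 klE0 *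
                    hubbardGridSub L M β (2 * (2 * M))) (((q', σ'.rev), 0) : GridLeg (GridPoint L (2 * (2 * M)))) ((p', σ'.rev), 1)))))) •
            (gen ℂ (((p', σ'), 0) : GridLeg (GridPoint L (2 * (2 * M)))) * gen ℂ (((q', σ'), 1) : GridLeg (GridPoint L (2 * (2 * M))))))) (omega0 M, pp) σσ).re +
        (selfEnergy L M β (ExteriorAlgebra.map (Matrix.toLin' (gridSubMatrix L M β
            (fun p : GridPoint L (2 * (2 * M)) => p.2) (fun p => gridTime β (2 * (2 * M)) p.1)))
          (∑ p' : GridPoint L (2 * (2 * M)), ∑ q' : GridPoint L (2 * (2 * M)), ∑ σ' : Fin 2,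
          (if p' = q' then (0 : ℂ) else
            -((((U * (β / (2 * (2 * M) : ℕ)) : ℝ) : ℂ) ^ 2 *
              (contr ℂ ((hubbardGridSub L M β (2 * (2 * M))).transpose * hubbardCovAboveCT L M β μ 0 0 klE0 *
                  hubbardGridSub L M β (2 * (2 * M))) (((q', σ'), 0) : GridLeg (GridPoint L (2 * (2 * M)))) ((p', σ'), 1) *
                (contr ℂ ((hubbardGridSub L M β (2 * (2 * M))).transpose * hubbardCovAboveCT L M β μ 0 0 klE0 *
                    hubbardGridSub L M β (2 * (2 * M))) (((p', σ'.rev), 0) : GridLeg (GridPoint L (2 * (2 * M)))) ((q', σ'.rev), 1) *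
                  contr ℂ ((hubbardGridSub L M β (2 * (2 * M))).transpose * hubbardCovAboveCT L M β μ 0 0 klE0 *
                    hubbardGridSub L M β (2 * (2 * M))) (((q', σ'.rev), 0) : GridLeg (GridPoint L (2 * (2 * M)))) ((p', σ'.rev), 1)))))) •
            (gen ℂ (((p', σ'), 0) : GridLeg (GridPoint L (2 * (2 * M)))) * gen ℂ (((q', σ'), 1) : GridLeg (GridPoint L (2 * (2 * M))))))) ((omega0 M).rev, pp) σσ).re)) / 4))
        (WithLp.toLp 2 (klFermiPoint μ 0 θ))) θ| ≤ sS k * U ^ 2)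
    (hD12 : ∀ θ : ℝ, ‖iteratedDeriv 1 (fun θ : ℝ => (WithLp.toLp 2 (klFermiPoint μ 0 θ) : Momentum)) θ‖ ≤ D₁ ∧ ‖iteratedDeriv 2 (fun θ : ℝ => (WithLp.toLp 2 (klFermiPoint μ 0 θ) : Momentum)) θ‖ ≤ D₂)
    (hfit : bS 1 * D₁ + (1 + D₁ + D₂ + 6500000000 + 99000000000000) ^ 4 / (10 : ℝ) ^ 78 ≤ (2 : ℝ) ^ 10 ∧
        bS 2 * D₁ ^ 2 + bS 1 * D₂ + (1 + D₁ + D₂ + 6500000000 + 99000000000000) ^ 4 / (10 : ℝ) ^ 78 ≤ (2 : ℝ) ^ 4 ∧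
        sS 3 + (1 + D₁ + D₂ + 6500000000 + 99000000000000) ^ 4 / (10 : ℝ) ^ 78 ≤ (2 : ℝ) ^ 4 ∧ sS 4 + (1 + D₁ + D₂ + 6500000000 + 99000000000000) ^ 4 / (10 : ℝ) ^ 78 ≤ (2 : ℝ) ^ 11) :
    TwoLegReadJetBound L M klC4aJetC2 (klC4aJetC' P R) β U μ (klFlowFrameU L M β U μ 0) 0 ∧
      TwoLegReadOscAt L M (klReadOscC P R) β U μ (klFlowFrameU L M β U μ 0) 0 := by
  have h34 := fun θ => freeFermiPointLp_sizes_numeral (μ := μ) hμ θ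
  refine twoLegRead_frameZero_registered_of_records (L := L) (M := M) P R hβ hμ hU hUb hL hM hS12 hSjet
    (D := fun i => if i = 1 then D₁ else if i = 2 then D₂ else if i = 3 then 6500000000 else 99000000000000) (fun θ i hi1 hi4 => ?_) ?_
  · interval_cases i
    · exact (hD12 θ).1
    · exact (hD12 θ).2
    · exact (h34 θ).2.2.1
    · exact (h34 θ).2.2.2
  · exact hfit

/-- **THE (C) CLOSER'S PREFIX FORM IN THE SIX-NUMBER CURRENCY**: from ONE pointwise record hypothesis `hrec` (at every `μ ∈ klWindowC`, `0 < U ≤ klTailBookU`, regime `β, L, M`: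
the four fits, `‖γ₀′‖ ≤ D₁`, `‖γ₀″‖ ≤ D₂`, the #22a rows k = 1, 2, the #22b rows k = 3, 4), for EVERY `G`, `Q`, under the (C) closer's literal binders:
`TwoLegReadJetBound L M klC4aJetC2 (klC4aJetC′ P R) β U μ (K₀) 0 ∧ TwoLegReadOscAt L M (klReadOscC P R) β U μ (K₀) 0`. [cite: BenfattoGiulianiMastropietro2006, §2.4 Lemma 2.1 (2.36)-(2.42)] -/
theorem twoLegRead_frameZero_registered_klEngGQ_of_records₁₂ (G : GeoConsts) (Q : EngConsts)
    (hrec : ∀ (μ U β : ℝ) (L M : ℕ) [NeZero L] [NeZero M], μ ∈ klWindowC → 0 < U → U ≤ klTailBookU → klBetaMin ≤ β →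
      klEngL₃ β U ≤ L → klEngM₃ β U L ≤ M →
      ∃ (bS sS : ℕ → ℝ) (D₁ D₂ : ℝ),
        (bS 1 * D₁ + (1 + D₁ + D₂ + 6500000000 + 99000000000000) ^ 4 / (10 : ℝ) ^ 78 ≤ (2 : ℝ) ^ 10 ∧
        bS 2 * D₁ ^ 2 + bS 1 * D₂ + (1 + D₁ + D₂ + 6500000000 + 99000000000000) ^ 4 / (10 : ℝ) ^ 78 ≤ (2 : ℝ) ^ 4 ∧
        sS 3 + (1 + D₁ + D₂ + 6500000000 + 99000000000000) ^ 4 / (10 : ℝ) ^ 78 ≤ (2 : ℝ) ^ 4 ∧ sS 4 + (1 + D₁ + D₂ + 6500000000 + 99000000000000) ^ 4 / (10 : ℝ) ^ 78 ≤ (2 : ℝ) ^ 11) ∧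
        (∀ θ : ℝ, ‖iteratedDeriv 1 (fun θ : ℝ => (WithLp.toLp 2 (klFermiPoint μ 0 θ) : Momentum)) θ‖ ≤ D₁ ∧ ‖iteratedDeriv 2 (fun θ : ℝ => (WithLp.toLp 2 (klFermiPoint μ 0 θ) : Momentum)) θ‖ ≤ D₂) ∧
        (∀ k, 1 ≤ k → k ≤ 2 → ∀ (σ : Fin 2) (p₀ : GridPoint L (2 * (2 * M))), ∑ p₁ : GridPoint L (2 * (2 * M)),
          (if p₁ = p₀ then (0 : ℝ) else
            Real.sqrt ((((p₁.2 - p₀.2) 0).valMinAbs.natAbs : ℝ) ^ 2 + (((p₁.2 - p₀.2) 1).valMinAbs.natAbs : ℝ) ^ 2) ^ k * ‖contr ℂ ((hubbardGridSub L M β (2 * (2 * M))).transpose * hubbardCovAboveCT L M β μ 0 0 klE0 *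
                    hubbardGridSub L M β (2 * (2 * M))) (((p₁, σ), 0) : GridLeg (GridPoint L (2 * (2 * M)))) ((p₀, σ), 1) *
                  (contr ℂ ((hubbardGridSub L M β (2 * (2 * M))).transpose * hubbardCovAboveCT L M β μ 0 0 klE0 *
                    hubbardGridSub L M β (2 * (2 * M))) (((p₀, σ.rev), 0) : GridLeg (GridPoint L (2 * (2 * M)))) ((p₁, σ.rev), 1) *
                    contr ℂ ((hubbardGridSub L M β (2 * (2 * M))).transpose * hubbardCovAboveCT L M β μ 0 0 klE0 *
                    hubbardGridSub L M β (2 * (2 * M))) (((p₁, σ.rev), 0) : GridLeg (GridPoint L (2 * (2 * M)))) ((p₀, σ.rev), 1))‖) ≤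
            bS k * (((2 * (2 * M) : ℕ) : ℝ) / β)) ∧
        (∀ k, 3 ≤ k → k ≤ 4 → ∀ θ : ℝ, |iteratedDeriv k (fun θ : ℝ => evalM (symInterp L (fun pp : TorusSite 2 L =>
            (∑ σσ : Fin 2, ((selfEnergy L M β (ExteriorAlgebra.map (Matrix.toLin' (gridSubMatrix L M β
                (fun p : GridPoint L (2 * (2 * M)) => p.2) (fun p => gridTime β (2 * (2 * M)) p.1)))
              (∑ p' : GridPoint L (2 * (2 * M)), ∑ q' : GridPoint L (2 * (2 * M)), ∑ σ' : Fin 2,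
              (if p' = q' then (0 : ℂ) else
                -((((U * (β / (2 * (2 * M) : ℕ)) : ℝ) : ℂ) ^ 2 *
                  (contr ℂ ((hubbardGridSub L M β (2 * (2 * M))).transpose * hubbardCovAboveCT L M β μ 0 0 klE0 *
                      hubbardGridSub L M β (2 * (2 * M))) (((q', σ'), 0) : GridLeg (GridPoint L (2 * (2 * M)))) ((p', σ'), 1) *
                    (contr ℂ ((hubbardGridSub L M β (2 * (2 * M))).transpose * hubbardCovAboveCT L M β μ 0 0 klE0 *
                        hubbardGridSub L M β (2 * (2 * M))) (((p', σ'.rev), 0) : GridLeg (GridPoint L (2 * (2 * M)))) ((q', σ'.rev), 1) *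
                      contr ℂ ((hubbardGridSub L M β (2 * (2 * M))).transpose * hubbardCovAboveCT L M β μ 0 0 klE0 *
                        hubbardGridSub L M β (2 * (2 * M))) (((q', σ'.rev), 0) : GridLeg (GridPoint L (2 * (2 * M)))) ((p', σ'.rev), 1)))))) •
                (gen ℂ (((p', σ'), 0) : GridLeg (GridPoint L (2 * (2 * M)))) * gen ℂ (((q', σ'), 1) : GridLeg (GridPoint L (2 * (2 * M))))))) (omega0 M, pp) σσ).re +
            (selfEnergy L M β (ExteriorAlgebra.map (Matrix.toLin' (gridSubMatrix L M β
                (fun p : GridPoint L (2 * (2 * M)) => p.2) (fun p => gridTime β (2 * (2 * M)) p.1)))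
              (∑ p' : GridPoint L (2 * (2 * M)), ∑ q' : GridPoint L (2 * (2 * M)), ∑ σ' : Fin 2,
              (if p' = q' then (0 : ℂ) else
                -((((U * (β / (2 * (2 * M) : ℕ)) : ℝ) : ℂ) ^ 2 *
                  (contr ℂ ((hubbardGridSub L M β (2 * (2 * M))).transpose * hubbardCovAboveCT L M β μ 0 0 klE0 *
                      hubbardGridSub L M β (2 * (2 * M))) (((q', σ'), 0) : GridLeg (GridPoint L (2 * (2 * M)))) ((p', σ'), 1) *
                    (contr ℂ ((hubbardGridSub L M β (2 * (2 * M))).transpose * hubbardCovAboveCT L M β μ 0 0 klE0 *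
                        hubbardGridSub L M β (2 * (2 * M))) (((p', σ'.rev), 0) : GridLeg (GridPoint L (2 * (2 * M)))) ((q', σ'.rev), 1) *
                      contr ℂ ((hubbardGridSub L M β (2 * (2 * M))).transpose * hubbardCovAboveCT L M β μ 0 0 klE0 *
                        hubbardGridSub L M β (2 * (2 * M))) (((q', σ'.rev), 0) : GridLeg (GridPoint L (2 * (2 * M)))) ((p', σ'.rev), 1)))))) •
                (gen ℂ (((p', σ'), 0) : GridLeg (GridPoint L (2 * (2 * M)))) * gen ℂ (((q', σ'), 1) : GridLeg (GridPoint L (2 * (2 * M))))))) ((omega0 M).rev, pp) σσ).re)) / 4))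
            (WithLp.toLp 2 (klFermiPoint μ 0 θ))) θ| ≤ sS k * U ^ 2)) :
    ∀ (P : SplitConsts) (R : RenConsts) (c : ℝ), P.WF → R.WF2 → 0 < c → c ≤ klEngC₃7GU G P R →
      ∀ μ ∈ klWindowC, ∀ U : ℝ, 0 < U → U ≤ klEngU₀12GQ G Q P R c → ∀ β : ℝ, klBetaMin ≤ β → β ≤ Real.exp (c / U ^ 2) →
        ∀ (L M : ℕ) [NeZero L] [NeZero M], klEngL₄ P R β U ≤ L → klEngM₃ β U L ≤ M →
          TwoLegReadJetBound L M klC4aJetC2 (klC4aJetC' P R) β U μ (klFlowFrameU L M β U μ 0) 0 ∧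
            TwoLegReadOscAt L M (klReadOscC P R) β U μ (klFlowFrameU L M β U μ 0) 0 := by
  intro P R c _ _ _ _ μ hμ U hU hU12 β hβ _ L M _ _ hL hM
  have hUb : U ≤ klTailBookU := hU12.trans (klEngU₀12GQ_le_klTailBookU G Q P R c)
  have hL3 : klEngL₃ β U ≤ L := klEngL₃_le_of_klEngL₄_le hL
  obtain ⟨bS, sS, D₁, D₂, hfit, hD12, hS12, hSjet⟩ := hrec μ U β L M hμ hU hUb hβ hL3 hM
  exact twoLegRead_frameZero_registered_of_records₁₂ (L := L) (M := M) P R hβ hμ hU hUb hL3 hM hS12 hSjet hD12 hfit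

end Summit.HubbardSuperconductivity.HubbardSuperconductivity.Theorems.KLRegimeSplit

end
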